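import Summits.BirchSwinnertonDyer.Rank1Residual.GaloisImage.LocalThreeTorsionAdicCompletion
import Summits.BirchSwinnertonDyer.Rank1Residual.GaloisImage.LocalTorsionAwayFromPAdicCompletion
import Summits.BirchSwinnertonDyer.Rank1Residual.GaloisImage.VisibleLowerBoundThreeNonsplit
import Summits.BirchSwinnertonDyer.Rank1Residual.GaloisImage.PadicTwistClassDecider
import Summits.BirchSwinnertonDyer.Rank1Residual.Additive.X4RankZeroVisibleLowerBoundPrimeList
import Summits.BirchSwinnertonDyer.Rank1Residual.Additive.IntModelTamagawaCertificateLocal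
import Summits.BirchSwinnertonDyer.Rank1Residual.X11b.VisibilityPrimeList
import Summits.BirchSwinnertonDyer.Rank1Residual.X11b.ChaPairsMinimality
import Summits.BirchSwinnertonDyer.Rank1Residual.X10.CasselsTatePairingRecordsB
import Summits.BirchSwinnertonDyer.Rank1Residual.X10.SelfTwistVisibleRecord322624k
import Summits.BirchSwinnertonDyer.BirchSwinnertonDyer.Theorems.Rank1ResidualIntModelReduction
import Literature.NumberTheory.EllipticCurves.HondaStrongIsomorphismMultiplicativeProofs
import Literature.NumberTheory.EllipticCurves.SelmerCorankControlRatProofs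
import HarnessLib

/-!
# N2 (X10b @ 3): the SELF-TWIST visible lower bound for the CTP target `305762d1` — `Ш(E)[3] ≠ 0` from the
# rank-2 self-twist `305762c1` with the place `3` PAID and the multiplicative place `2` FREE of kind (iii)
# (cell `b2b-bsdres`, unit `b2b-bsdres-x10` = N2 class lead, GEN 21; per-pair RECORD, closes nothing)

HONEST FRAMING (cell `b2b-bsdres`, run/shared/lean/b2b/bsd-rank1-residual/, verbatim in every
file): the goal of the cell is to DELETE the COMBINATION-SHAPED residual classes of the
Birch–Swinnerton-Dyer formula for ALL analytic-rank `≤ 1` elliptic curves over `ℚ` — "full BSD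
formula for every rank `≤ 1` curve in class `C`" assembled STRICTLY from published theorems — so
that the rank-`≤ 1` remainder becomes exactly the CONSTRUCTION-SHAPED classes, which are TYPED
(missing-input `Prop`s), NOT attempted. This is not "finishing BSD". Class X10b (= N2) stays
CONSTRUCTION-SHAPED (NEEDS `X_A3`); this file is a PER-PAIR RECORD of the LOWER half only; nothing is
booked; no mark / label / tier / count is changed. Theorems only (no definition, no named fact, no
`sorry`).

## What

Second instance of the N2 self-twist visibility road (x10 GEN 21, `HOME/b2b-bsdres-x10/g21/selftwist/SELF-TWIST-LAW.md`;
first instance `X10/SelfTwistVisibleRecord322624k.lean`), now with a MULTIPLICATIVE place handled by a FREE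
kind instead of being paid: **`E = 305762d1 = [1, 1, 0, -165191105, -959737799051]`** (`N = 305762 = 2·17²·23²`,
non-split multiplicative at `2`, good ordinary non-anomalous at `3`, image `3Ns`, `d* = -23`, `r_an = 0`,
`#Ш_an = 9`; CTP target of x10's fourteen) and its self-twist **`E′ = 305762c1 = [1, 1, 0, -312270, 78744628]`**
(`= E ⊗ χ_{-23}`; rank `2`, Cremona generators `(1531, 55734)`, `(-17619/9, 70222/27)`; `#Ш_an(E′) = 1`).
The refined count `Visible.exists_sha_ne_zero_three_of_congr_of_places₄` (n1011-p04) with `S` = places over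
`[2, 3, 17, 23]` (`|Δ(E)| = 2⁹·17⁹·23⁹`, `|Δ(E′)| = 2⁹·17⁹·23³`), `T = {3}` PAID at cost `#E′(ℚ₃)[3] · #(ℤ₃/3) =
1 · 3 < 9 = 3^{rank E′}` (n1011-p17's decider: `E′(ℚ₃)[3] = 0`), and off `T`: `2` of kind (iii) — BOTH curves
multiplicative at `2`, same twist class `γ(E)/γ(E′) = -1/23 ∈ (ℚ₂ˣ)²` (`-23 ≡ 1 mod 8`) and `μ₃(ℚ₂) = 1`
(p17's `sqFlagAt` numerals) —, `17` (additive `I*`-type, `E′(ℚ₁₇)[3] = 0`) and `23` (additive `III`,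
`c = 2`, `E′(ℚ₂₃)[3] = 0`) of kind (i) — TamLocal certificates from n1011-p18's glue `vis3_certs.py`
UNCHANGED, re-decided here.  `E[3]` irreducible from the Frobenius witness `ℓ = 7` over x10 GEN 12's landed
point count `X10.card_t305762d1_7`.
* `irr3_v305762d1`; `tamLocal_check_305762c1_17`, `tamLocal_check_305762c1_23`;
* **`exists_sha_three_selfTwist_v305762d1`** — `∃ c ∈ Ш(E), c ≠ 0, 3c = 0` (CONDITIONAL on the two
  Tate-uniformisation named facts `hU`, `hU2` that kind (iii) uses);
* **`sq_dvd_card_sha_three_selfTwist_v305762d1`** — `3² ∣ #Ш(E)[3^∞]`;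
* **`missingLowerBoundAt_three_selfTwist_v305762d1`** — `MissingLowerBoundAt W 3` given `#Ш_an = 9`.
BINDERS LEFT (displayed): `hU`, `hU2` (Silverman ATAEC V.5.3 / V.5.4), `hCT`, `hGZK`, `hr : r_an(E) = 0`,
`θ : E′[3] ≃ E[3]` with `hθ` (the self-twist congruence; EVIDENCE: cc-eng-2 KO-certified row 305762d/305762c,
bound 84 455, 8 229 primes, kit j123296), `hrank : 2 ≤ rank E′(ℚ)`, `hq : #Ш_an = 9`.

References: [CremonaMazur2000] §3; [AgasheStein2002] Thm. 3.1; [MilneADT2006] I Prop. 3.8;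
[SilvermanATAEC1994] IV.9.4, V.5.3–5.4; [SilvermanAEC2009] VII.5.1, X.4.14; [Mazur1978] Prop. 6.3 (1);
[Cremona2006] Table 1 (labels 305762d1, 305762c1).
-/

set_option autoImplicit false

noncomputable section

open scoped Classical NumberField
open IsDedekindDomain NumberField WeierstrassCurve Rat.HeightOneSpectrum
  Literature.NumberTheory.EllipticCurves Literature.NumberTheory.EllipticCurves.ModularForms
  Literature.NumberTheory.EllipticCurves.Rank1Residual
  Literature.NumberTheory.EllipticCurves.Rank1Residual.Typed
  Literature.NumberTheory.GaloisRepresentations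
  Summit.BirchSwinnertonDyer.BirchSwinnertonDyer.Rank1Residual.IntModel
  Summit.BirchSwinnertonDyer.BirchSwinnertonDyer.Rank1Residual.X11RankOne
  Summit.BirchSwinnertonDyer.BirchSwinnertonDyer.Rank2Observatory
  Summit.BirchSwinnertonDyer.BirchSwinnertonDyer.Rank2Observatory.Tam
  Summit.BirchSwinnertonDyer.Rank1Residual.GaloisImage
  Summit.BirchSwinnertonDyer.Rank1Residual.GaloisImage.LocalTorsion3At
  Summit.BirchSwinnertonDyer.Rank1Residual.Additive
  Summit.BirchSwinnertonDyer.Rank1Residual.X11b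

namespace Summit.BirchSwinnertonDyer.Rank1Residual.X10.SelfTwist

/-! ### E-side kernel fact for `305762d1` (point count at `7` = x10 GEN 12's `X10.card_t305762d1_7`; the rootless-mod-3 numeral is the same as 322624k1's, reused from `SelfTwistVisibleRecord322624k`) -/

/-- **`E[3]` is irreducible for Cremona 305762d1** (Frobenius witness `ℓ = 7`, `#Ẽ(𝔽₇) = 5`). [cite: Mazur1978, §6 Prop. 6.3 (1) (p. 153)] -/
theorem irr3_v305762d1 {W : WeierstrassCurve ℚ} [W.IsElliptic] [W.IsGloballyMinimal]
    (hI : integralModelInt W = ⟨1, 1, 0, -165191105, -959737799051⟩) : W.HasIrreducibleModPGaloisRep 3 :=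
  haveI : Fact (Nat.Prime 3) := ⟨Nat.prime_three⟩
  haveI : Fact (Nat.Prime 7) := ⟨by norm_num⟩
  hasIrreducibleModPGaloisRep_of_intModel_of_noroot hI 3 7 (by norm_num) (by decide +kernel)
    Summit.BirchSwinnertonDyer.Rank1Residual.X10.card_t305762d1_7 noroot3_frob_v322624k1_7

/-! ### The partner's Tate certificates at `17` and `23` -/

/-- The local Tamagawa certificate of `305762c1` at `17` (`⟨17, 4, 5, 0, 1531, 8, 16430, 9, 71, 1, 4⟩`, additive `I*`-type). [cite: SilvermanATAEC1994, IV.9.4] -/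
theorem tamLocal_check_305762c1_17 :
    TamLocal.check ⟨17, 4, 5, 0, 1531, 8, 16430, 9, 71, 1, 4⟩ ⟨1, 1, 0, -312270, 78744628⟩ = true := by
  decide +kernel

/-- The local Tamagawa certificate of `305762c1` at `23` (`⟨23, 4, 4, 0, 13, 0, 5, 3, 3, 2, 2⟩`, additive type `III`, `c = 2`). [cite: SilvermanATAEC1994, IV.9.4] -/
theorem tamLocal_check_305762c1_23 :
    TamLocal.check ⟨23, 4, 4, 0, 13, 0, 5, 3, 3, 2, 2⟩ ⟨1, 1, 0, -312270, 78744628⟩ = true := by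
  decide +kernel

/-! ### The visible element of `Ш(305762d1)[3]` -/

/-- **SELF-TWIST VISIBILITY RECORD (closes nothing, moves no mark): a non-zero `3`-torsion element of
`Ш(E/ℚ)` for `E = 305762d1` from its rank-2 self-twist `E′ = 305762c1`** — place `3` paid (`3 < 9`),
place `2` free of kind (iii) (both multiplicative, same twist class, `μ₃(ℚ₂) = 1`), places `17`, `23` free of
kind (i); CONDITIONAL on the Tate-uniformisation facts `hU`, `hU2`. [cite: CremonaMazur2000, §3 and Table 1]
[cite: MilneADT2006, Ch. I Prop. 3.8] [cite: Cremona2006, Table 1 (labels 305762d1, 305762c1)] -/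
theorem exists_sha_three_selfTwist_v305762d1
    (hU : Silverman1994_thmV53_tateUniformisation.{0})
    (hU2 : Silverman1994_thmV53_corV54_tateUniformisation.{0})
    (hGZK : rank_eq_analyticRank_of_analyticRank_le_one)
    (W : WeierstrassCurve ℚ) [W.IsElliptic] [W.IsGloballyMinimal]
    (hI : integralModelInt W = ⟨1, 1, 0, -165191105, -959737799051⟩) (hr : W.analyticRank = 0)
    (W' : WeierstrassCurve ℚ) (hW' : W' = ⟨1, 1, 0, -312270, 78744628⟩) [W'.IsElliptic]
    (θ : geomTorsion W' ((3 : ℕ) : ℤ) ≃+ geomTorsion W ((3 : ℕ) : ℤ))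
    (hθ : ∀ (σ : Field.absoluteGaloisGroup ℚ) (P : geomTorsion W' ((3 : ℕ) : ℤ)), θ (σ • P) = σ • θ P)
    (hrank : 2 ≤ W'.mordellWeilRank) :
    ∃ c : W.sha, c ≠ 0 ∧ 3 • c = 0 := by
  haveI : Fact (Nat.Prime 3) := ⟨Nat.prime_three⟩
  haveI : Fact (Nat.Prime 2) := ⟨by norm_num⟩
  haveI : Fact (Nat.Prime 17) := ⟨by norm_num⟩
  haveI : Fact (Nat.Prime 23) := ⟨by norm_num⟩
  -- the row `305762d1`: `E(ℚ)` finite of order prime to `3`; rational model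
  have hfin : Finite W.toAffine.Point := finite_point_of_analyticRank_eq_zero W hGZK hr
  haveI := hfin
  have hcop : (Nat.card W.toAffine.Point).Coprime 3 := coprime_natCard_point_of_irr W 3 (irr3_v305762d1 hI)
  have hE : (⟨1, 1, 0, -165191105, -959737799051⟩ : WeierstrassCurve ℤ).map (Int.castRingHom ℚ) = W := by
    rw [IntModelTam.eq_baseChange_of_integralModelInt hI]; rfl
  have hWq : W = ⟨1, 1, 0, -165191105, -959737799051⟩ := by
    rw [← hE]; exact map_mk_int 1 1 0 (-165191105) (-959737799051)
  -- the partner `305762c1`: globally minimal, integral model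
  have hM' : W'.IsGloballyMinimal := by
    rw [hW']
    exact isGloballyMinimal_of_krausCriterion_bounded₂ 1 1 0 (-312270) 78744628
      (by decide +kernel) (by decide +kernel) (by decide +kernel)
  have hI' : integralModelInt W' = ⟨1, 1, 0, -312270, 78744628⟩ := by
    subst hW'; exact integralModelInt_eq_of_map_eq _ (map_mk_int 1 1 0 (-312270) 78744628)
  have hF : (⟨1, 1, 0, -312270, 78744628⟩ : WeierstrassCurve ℤ).map (Int.castRingHom ℚ) = W' := by
    rw [hW']; exact map_mk_int 1 1 0 (-312270) 78744628
  -- prime support of the two discriminants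
  have hΔE : ∀ q : ℕ, q.Prime → (q : ℤ) ∣ (⟨1, 1, 0, -165191105, -959737799051⟩ : WeierstrassCurve ℤ).Δ →
      q ∈ [2, 3, 17, 23] :=
    X11b.forall_mem_of_natAbs_eq_prod_pow [2, 3, 17, 23] [9, 0, 9, 9]
      (by intro q hq; simp only [List.mem_cons, List.mem_nil_iff, or_false] at hq; rcases hq with rfl | rfl | rfl | rfl <;> norm_num)
      (by decide +kernel)
  have hΔF : ∀ q : ℕ, q.Prime → (q : ℤ) ∣ (⟨1, 1, 0, -312270, 78744628⟩ : WeierstrassCurve ℤ).Δ → q ∈ [2, 3, 17, 23] :=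
    X11b.forall_mem_of_natAbs_eq_prod_pow [2, 3, 17, 23] [9, 0, 9, 3]
      (by intro q hq; simp only [List.mem_cons, List.mem_nil_iff, or_false] at hq; rcases hq with rfl | rfl | rfl | rfl <;> norm_num)
      (by decide +kernel)
  -- the finite set `S` of places over `[2, 3, 17, 23]` and `T = {the place of 3}`
  set e := Rat.HeightOneSpectrum.primesEquiv (R := 𝓞 ℚ) with he
  set L : List ℕ := [2, 3, 17, 23] with hLdef
  set S : Finset (HeightOneSpectrum (𝓞 ℚ)) :=
    (L.filterMap fun q ↦ if h : q.Prime then some (e.symm ⟨q, h⟩) else none).toFinset with hSdef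
  have hmemS : ∀ v : HeightOneSpectrum (𝓞 ℚ), v ∈ S ↔ (e v : ℕ) ∈ L := by
    intro v
    rw [hSdef, List.mem_toFinset, List.mem_filterMap]
    constructor
    · rintro ⟨q, hq, hqv⟩
      by_cases hqp : q.Prime
      · rw [dif_pos hqp, Option.some.injEq] at hqv
        rw [← hqv, Equiv.apply_symm_apply]
        exact hq
      · rw [dif_neg hqp] at hqv
        exact absurd hqv (by simp)
    · intro hv
      refine ⟨(e v : ℕ), hv, ?_⟩
      rw [dif_pos (e v).2]
      simp
  set v₃ : HeightOneSpectrum (𝓞 ℚ) := e.symm ⟨3, Nat.prime_three⟩ with hv₃def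
  have hv₃ : (e v₃ : ℕ) = 3 := by rw [hv₃def, Equiv.apply_symm_apply]
  have hv₃_of : ∀ v : HeightOneSpectrum (𝓞 ℚ), (e v : ℕ) = 3 → v = v₃ := by
    intro v hv
    rw [hv₃def, Equiv.eq_symm_apply]
    exact Subtype.ext hv
  set T : Finset (HeightOneSpectrum (𝓞 ℚ)) := {v₃} with hTdef
  have hTS : T ⊆ S := by
    intro v hv
    rw [hTdef, Finset.mem_singleton] at hv
    rw [hmemS, hv, hv₃, hLdef]; simp
  -- the budget at `T = {3}`: `#E′(ℚ₃)[3] · #(ℤ₃/3) = 1 · 3 < 9 ≤ 3 ^ rank E′`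
  have hker3 : Nat.card (nsmulAddMonoidHom 3 :
      (W'.baseChange (v₃.adicCompletion ℚ)).toAffine.Point →+ _).ker = 1 :=
    LocalTorsion3.natCard_ker_nsmul_three_adicCompletion_eq_one_of_check 1 1 0 (-312270) 78744628
      (by decide +kernel) (k := 2) (cert := [((2 : ℤ), 1, 3, 0)]) (by decide +kernel) W' hW' hv₃
  have hquot3 : Nat.card (v₃.adicCompletionIntegers ℚ ⧸
      Ideal.span {((3 : ℕ) : v₃.adicCompletionIntegers ℚ)}) = 3 := by
    have h := WeierstrassCurve.prod_natCard_quot_adicCompletionIntegers (K := ℚ) (p := 3) ({v₃} : Finset _)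
      (fun v hv h3 ↦ hv (by
        rw [Finset.mem_singleton]
        exact hv₃_of v (Rat.HeightOneSpectrum.primesEquiv_eq_of_natCast_mem v Nat.prime_three h3)))
    rw [Finset.prod_singleton, Module.finrank_self, pow_one] at h
    exact_mod_cast h
  have hT : (∏ w ∈ T, Nat.card (nsmulAddMonoidHom 3 :
        (W'.baseChange (w.adicCompletion ℚ)).toAffine.Point →+ _).ker *
        Nat.card (w.adicCompletionIntegers ℚ ⧸
          Ideal.span {((3 : ℕ) : w.adicCompletionIntegers ℚ)})) < 3 ^ W'.mordellWeilRank := by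
    rw [hTdef, Finset.prod_singleton, hker3, hquot3]
    calc 1 * 3 < 3 ^ 2 := by norm_num
      _ ≤ 3 ^ W'.mordellWeilRank := Nat.pow_le_pow_right (by norm_num) hrank
  refine Visible.exists_sha_ne_zero_three_of_congr_of_places₄ hU hU2 W W' θ hθ S T hTS (fun w hwS ↦ ?_) hfin hcop hT
    (fun w hwS hwT ↦ ?_)
  · -- good reduction of both curves outside `S`, and `w ∤ 3`
    have hwL : (e w : ℕ) ∉ L := fun h ↦ hwS ((hmemS w).mpr h)
    have hq : (e w : ℕ).Prime := (e w).2
    refine ⟨?_, ?_, fun h3w ↦ hwL ?_⟩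
    · rw [← hE]
      exact hasGoodReductionAt_map_of_not_dvd _ w fun h ↦ hwL (hΔE _ hq h)
    · rw [← hF]
      exact hasGoodReductionAt_map_of_not_dvd _ w fun h ↦ hwL (hΔF _ hq h)
    · rw [he, Rat.HeightOneSpectrum.primesEquiv_eq_of_natCast_mem w Nat.prime_three h3w, hLdef]
      simp
  · -- the places of `S \ T`: `2` (kind iii), `17`, `23` (kind i)
    have hwL : (e w : ℕ) ∈ L := (hmemS w).mp hwS
    have hw3 : (e w : ℕ) ≠ 3 := fun h ↦ hwT (by rw [hTdef, Finset.mem_singleton]; exact hv₃_of w h)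
    have h3w : ((3 : ℕ) : 𝓞 ℚ) ∉ w.asIdeal := fun h ↦
      hw3 (Rat.HeightOneSpectrum.primesEquiv_eq_of_natCast_mem w Nat.prime_three h)
    rw [hLdef] at hwL
    simp only [List.mem_cons, List.mem_nil_iff, or_false] at hwL
    rcases hwL with h2 | h3 | h17 | h23
    · -- `w = 2`: both curves multiplicative (non-split), same twist class `-1/23 ∈ (ℚ₂ˣ)²`, `μ₃(ℚ₂) = 1`
      refine Or.inr (Or.inr (Or.inl ⟨?_, ?_, ?_, ?_⟩))
      · refine W.hasMultiplicativeReductionAt_of_dvd_of_not_dvd w ?_ ?_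
        · rw [h2, minimalDiscriminantInt_eq hI]; decide +kernel
        · rw [h2, hI]; decide +kernel
      · haveI := hM'
        refine W'.hasMultiplicativeReductionAt_of_dvd_of_not_dvd w ?_ ?_
        · rw [h2, minimalDiscriminantInt_eq hI']; decide +kernel
        · rw [h2, hI']; decide +kernel
      · refine exists_eq_sq_mul_of_sqFlagAt w h2 (N := -1) (D := 23) ?_ (by norm_num) ?_ (w := 0)
          (by norm_num) (by norm_num) (by decide +kernel)
        · rw [hW']
          norm_num [WeierstrassCurve.c₄, WeierstrassCurve.c₆, WeierstrassCurve.b₂, WeierstrassCurve.b₄,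
            WeierstrassCurve.b₆]
        · rw [hWq, hW']
          norm_num [WeierstrassCurve.c₄, WeierstrassCurve.c₆, WeierstrassCurve.b₂, WeierstrassCurve.b₄,
            WeierstrassCurve.b₆]
      · exact forall_pow_three_eq_one_adicCompletion_of_sqFlagAt w h2 (w₃ := 0) (by norm_num) (by norm_num)
          (by decide +kernel)
    · exact absurd h3 hw3
    · -- `w = 17`: additive Kodaira In*, value set [2, 4]
      exact Or.inl ⟨h3w, LocalTorsionAway.natCard_ker_nsmul_adicCompletion_eq_one_of_intModel_of_additive_tamLocal_forall
        hI' 17 3 (by norm_num) h17 (by decide) (by decide) (E := ⟨17, 4, 5, 0, 1531, 8, 16430, 9, 71, 1, 4⟩) rfl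
        tamLocal_check_305762c1_17 (by decide)⟩
    · -- `w = 23`: additive type III, `c = 2`
      exact Or.inl ⟨h3w, LocalTorsionAway.natCard_ker_nsmul_adicCompletion_eq_one_of_intModel_of_additive hI' 23 3
        (by norm_num) h23 (by decide) (by decide)
        (IntModelTam.localTamagawaNumber_padic_eq_of_intModel_of_tamLocal hI' 23 (E := ⟨23, 4, 4, 0, 13, 0, 5, 3, 3, 2, 2⟩)
          rfl tamLocal_check_305762c1_23 (c := 2) (by decide)) (by norm_num)⟩

/-- **`3² ∣ #Ш(305762d1)[3^∞]`** from the visible element and the Cassels–Tate parity.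
[cite: SilvermanAEC2009, Thm. X.4.14] [cite: CremonaMazur2000, §3 and Table 1] -/
theorem sq_dvd_card_sha_three_selfTwist_v305762d1
    (hU : Silverman1994_thmV53_tateUniformisation.{0})
    (hU2 : Silverman1994_thmV53_corV54_tateUniformisation.{0})
    (hCT : exists_casselsTate_pairing (K := ℚ)) (hGZK : rank_eq_analyticRank_of_analyticRank_le_one)
    (W : WeierstrassCurve ℚ) [W.IsElliptic] [W.IsGloballyMinimal]
    (hI : integralModelInt W = ⟨1, 1, 0, -165191105, -959737799051⟩) (hr : W.analyticRank = 0)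
    (W' : WeierstrassCurve ℚ) (hW' : W' = ⟨1, 1, 0, -312270, 78744628⟩) [W'.IsElliptic]
    (θ : geomTorsion W' ((3 : ℕ) : ℤ) ≃+ geomTorsion W ((3 : ℕ) : ℤ))
    (hθ : ∀ (σ : Field.absoluteGaloisGroup ℚ) (P : geomTorsion W' ((3 : ℕ) : ℤ)), θ (σ • P) = σ • θ P)
    (hrank : 2 ≤ W'.mordellWeilRank) :
    3 ^ 2 ∣ Nat.card (AddCommGroup.primaryComponent W.sha 3) := by
  haveI : Finite W.sha := (hGZK W (by rw [hr]; exact zero_le_one)).2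
  exact Visible.sq_dvd_card_sha_three_of_exists_sha_torsion hCT W
    (exists_sha_three_selfTwist_v305762d1 hU hU2 hGZK W hI hr W' hW' θ hθ hrank)

/-- **The typed LOWER binder `MissingLowerBoundAt E 3` for `305762d1`** from the visible `3`-torsion
element, the Cassels–Tate squareness and `#Ш_an = 9` (`hq`, Cremona `allbsd`; evidence binder).
[cite: SilvermanAEC2009, Thm. X.4.14] [cite: Cremona2006, Table 1 (label 305762d1)] -/
theorem missingLowerBoundAt_three_selfTwist_v305762d1
    (hU : Silverman1994_thmV53_tateUniformisation.{0})
    (hU2 : Silverman1994_thmV53_corV54_tateUniformisation.{0})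
    (hCT : exists_casselsTate_pairing (K := ℚ)) (hGZK : rank_eq_analyticRank_of_analyticRank_le_one)
    (W : WeierstrassCurve ℚ) [W.IsElliptic] [W.IsGloballyMinimal]
    (hI : integralModelInt W = ⟨1, 1, 0, -165191105, -959737799051⟩) (hr : W.analyticRank = 0)
    {q : ℚ} (hq : shaAn W = (q : ℂ)) (hv : padicValRat 3 q ≤ 2)
    (W' : WeierstrassCurve ℚ) (hW' : W' = ⟨1, 1, 0, -312270, 78744628⟩) [W'.IsElliptic]
    (θ : geomTorsion W' ((3 : ℕ) : ℤ) ≃+ geomTorsion W ((3 : ℕ) : ℤ))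
    (hθ : ∀ (σ : Field.absoluteGaloisGroup ℚ) (P : geomTorsion W' ((3 : ℕ) : ℤ)), θ (σ • P) = σ • θ P)
    (hrank : 2 ≤ W'.mordellWeilRank) :
    haveI : Fact (Nat.Prime 3) := ⟨Nat.prime_three⟩
    MissingLowerBoundAt W 3 := by
  haveI : Fact (Nat.Prime 3) := ⟨Nat.prime_three⟩
  have hvis := exists_sha_three_selfTwist_v305762d1 hU hU2 hGZK W hI hr W' hW' θ hθ hrank
  exact missingLowerBoundAt_of_casselsTate_of_pow_dvd W 3 hCT (hGZK W (by rw [hr]; exact zero_le_one)).2 hq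
    (k := 1) (by simpa using hv) (by simpa using dvd_shaOrder_of_exists_torsion W 3 hvis)

end Summit.BirchSwinnertonDyer.Rank1Residual.X10.SelfTwist

end
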